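import Mathlib
import Literature.MathematicalPhysics.QuantumFieldTheory.Balaban1983to89.T4EtaRateDefect
import Literature.MathematicalPhysics.QuantumFieldTheory.Balaban1983to89.B11AxialTransport190
import Literature.MathematicalPhysics.QuantumFieldTheory.Balaban1983to89.B6Prop26Gluing
import Literature.MathematicalPhysics.QuantumLattice.BalabanRG

/-!
# `Balaban1983to89.T4EtaRateCoeffDefect` — kernel bookkeeping for T4-DAG node U1a (`t4/T4-EST-U1a.md` §3 STEP 2 =
NE2-LOCAL-A, §9 (N3)): THE η-DEFECT OF A COEFFICIENT.  Under the piecewise-constant pull-back `τ = (· ∘ π)` of a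
coarse lattice into a finer one, the intertwining defect `𝔇(M_{a′}, M_a) = M_{a′}τ − τM_a` (`T4EtaRateDefect.idef`) of
two MULTIPLICATION OPERATORS — the fine run's coefficient `a′` on the fine lattice, the coarse run's `a` on the coarse
one — IS multiplication by the FIT ERROR `a′ − a ∘ π` (`idef_mulOp_eq`); its sharp block majorant (`B11SectG.HasMaj`
between the sharp block norms `B11SectG.BlockNorm.ofBlocks`) is DIAGONAL, the blockwise sup of the fit error
(`hasMaj_idef_mulOp`); the fit error of the two admissible coarse coefficients (the SAMPLE `a′ ∘ σ` at a section of `π`,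
the straight BLOCK AVERAGE of `a′` over the fibres of `π`) is at most the within-fibre OSCILLATION of `a′` (`fit_sample`,
`fit_blockAvg`); on the blocks of side `M` of `ℤ^d` (`QuantumLattice.blockMap`) a per-bond bound `θ` on the differences
of `a′` along bonds INSIDE blocks gives the oscillation bound `d·(M − 1)·θ` (`osc_of_inBlockBondBound`); and with
`θ = η′·G`, `Mη′ = η` (fine spacing `η′`, coarse spacing `η`, `G` a bound on the fine lattice gradient of `a′`) this is
`≤ d·η·G` (`coeff_osc_rate`) `= (d·Gℓ)·(η/ℓ)` (`rate_reading`): the size `Gℓ` of the coefficient's own bound times ONE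
rate factor `η/ℓ = T4EtaRate.rateFactor` at `γ = 1` (`rateFactor_one`).  (Cell `pub-balaban`, unit
`b2b-balaban-pv25-g20` = the η-rate lineage of `T4EtaRate` / `T4RateAlgebra` / `T4EtaRateDefect` / `T4EtaRateDefectSite`
/ `T4EtaRateSiteOfRatePair` / `T4EtaRateSiteTorus` / `T4EtaRateOperatorTorus`; self-proposed row T4-U1a.S-NE2-COEFF-DEFECT°
under the yield clause of T4-DAG v25 §8 Q24(a); imports `T4EtaRateDefect` (pv25 gen 13), `B11AxialTransport190` (b11:
`abs_le_loc_ofBlocks`, `loc_ofBlocks_le`), `B6Prop26Gluing` (the tree's multiplication operator `mulOp`) and the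
prelude `QuantumLattice.BalabanRG` (`blockMap`) BY NAME, nothing in the tree modified; NO NEW ESTIMATE about the
audited construction, NOT summit progress.)

HONEST FRAMING (cell `pub-balaban`, T4-DAG PAGE 1).  The cell's T4 target is rung (B)+1: existence AND uniqueness of the
continuum limit of Bałaban's unit-scale averaged loop expectations on a FIXED finite torus — strictly beyond ultraviolet
stability ([Balaban1988Convergent] Cor. 3 p. 264; [Balaban1989LargeFieldII] Thm 1 p. 355); NOT infinite volume, NOT a
mass gap, NOT the Clay problem.  NOTHING comparing two lattice spacings is printed in [B6]/[B9]: the manuscripts construct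
ONE run; node U1a (= NE2⁺, the η-rate of the background propagators) is recorded in the cell as a NEW ESTIMATE assembled
from printed MECHANISMS (`t4/T4-EST-U1a.md` §4 verdict; cell GAPS G-t4-U1a-4′, G-t4-U1a-5).  `T4EtaRateDefect` reduced
it to PRIMITIVE DEFECT RATES (its census (N3): *"`ε_S` (of `𝔇(S′,S)`, source-weighted, rate `ρ`) and `m_K` (of
`𝔇(K′,K)`) — NOT PRINTED (one run is constructed); this is where NE2⁺'s content now sits"*), and among the primitives the
record's NE2-LOCAL-A (verbatim, `t4/T4-EST-U1a.md` §3 STEP 2): *"For general regular U the local operators carry the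
background through the covariant derivatives — multiplication operators built from A … and their η-derivatives.  The fine
run uses A′ … on the η′-bonds, the coarse run uses the field of Ū′ⁿ on the η-bonds, and their pull-back discrepancy is ≤
(η-scale variation of A′) ≤ O(1)Mα₀(L^jη)^{−2}·η by the gradient bound in (3.35) — RELATIVE size (η/L^jη)·O(1) compared
to the coefficient bound O(1)Mα₀(L^jη)^{−1}: a rate factor with γ = 1 at scale j. [analysis …]"*.  THIS MODULE TYPES THE
COEFFICIENT HALF OF THAT SENTENCE AND KERNEL-CHECKS IT: "pull-back discrepancy of a coefficient ≤ its η-scale variation ≤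
(number of in-block bonds on a monotone path)·(per-bond variation)", and the arithmetic "per-bond variation `η′G` ⟹
RELATIVE size one rate factor".  The printed input it is shaped on is the regularity condition (3.35) of
[Balaban1985BackgroundPropagators] p. 396 (verbatim, tree `B9.lean`): *"for an arbitrary cube □ of the described above
class, and for a configuration U there exists a gauge transformation u on □ such that U^u = e^{iηA}, and if the index of □
is j, then |A| < O(1)Mα₀(L^jη)^{−1}, |∇^ηA| < O(1)Mα₀(L^jη)^{−2} on □, where O(1)M is a size of □"* — cited as the
SHAPE of the binders `G` (gradient bound) and `Gℓ` (coefficient bound), never asserted; and the perturbation structure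
(3.50)–(3.53) p. 400 (the local operators are `Δ(1) +` terms built from `A` — the reason multiplication operators by
functions of the background are the coefficients in question), cited as MECHANISM only.

WHAT THIS MODULE IS (all declarations [folklore] = linear algebra, finite combinatorics and real arithmetic over
hypothesis-shaped data; `X`, `X′` arbitrary (finite, where block norms occur) index types, `π : X′ → X` the block
projection of the finer lattice onto the coarser, `g : B6.Geometry` the carrier of [B6] §2's cubes `𝔅`, `blk : X → 𝔅`
the site-to-cube map of the coarse lattice and `blk ∘ π` that of the fine one):
* §1 `pull π = (· ∘ π)` (Mathlib `LinearMap.funLeft`; convention (C2) of `t4/T4-EST-U1a.md`: piecewise-constant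
  pull-back), `B6Prop26Gluing.mulOp a` (multiplication by `a`, BY NAME); `idef_mulOp_apply` / `idef_mulOp_eq`:
  `𝔇(M_{a′}, M_a) = M_{a′ − a∘π} ∘ pull π`; `idef_mulOp_pull_self`: zero defect when `a′ = a ∘ π`.
* §2 `diagK o (y,y′) = 1_{y = y′}·o(y′)`; `loc_fine_mul_pull_le` (the one estimate: a fine function `c·(μ∘π)` with
  `|c| ≤ o ∘ blk ∘ π` has fine block sup `≤ o(y)·`coarse block sup of `μ`, and vanishes off the cube where `μ` lives);
  `hasMaj_pull` (`diagK 1`), `hasMaj_mulOp` (`diagK m`), `hasMaj_idef_mulOp` (`diagK o` from the FIT HYPOTHESIS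
  `|a′(x′) − a(πx′)| ≤ o(blk(πx′))`), and its SOURCE-WEIGHTED DECAY FORM `hasMaj_idef_mulOp_decay`
  (`ε·e^{−ρd(y,y′)}·w(y′)` whenever `o ≤ ε·w` and `d(y,y) = 0`) = literally the shape of the `hDS` slot of
  `T4EtaRateDefect.idef_neumann_majorant`.
* §3 `FibreOsc π a′ o` (`|a′(x₁) − a′(x₂)| ≤ o(πx₁)` on each fibre); `fit_sample` (`a = a′ ∘ σ`, `π ∘ σ = id`),
  `fibre` / `blockAvg` / `fit_blockAvg` (`a =` the fibre average; linearised (C3)); `hasMaj_idef_mulOp_sample`,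
  `hasMaj_idef_mulOp_blockAvg` (§2 ∘ §3).
* §4 ON `ℤ^d` (prelude `QuantumLattice.blockMap M = ⌊·/M⌋` coordinatewise, `M` = the spacing ratio of the two lattices,
  `L^n` for an η-PAIRING of `T4EtaRate`): `InBlockBondBound M a′ θ` (`|a′(x + e_μ) − a′(x)| ≤ θ(⌊x/M⌋)` for bonds with
  both ends in one block — a LOCATED hypothesis, block faces excluded); `axis_telescope`, `mix` (change the coordinates
  of `x₁` into those of `x₂` one at a time: every intermediate point stays in the block, `blockMap_mix`),
  `abs_sub_le_of_ediv_eq` (two integers with the same `⌊·/M⌋` differ by `≤ M − 1`), and `osc_of_inBlockBondBound`: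
  `⌊x₁/M⌋ = ⌊x₂/M⌋ ⟹ |a′(x₂) − a′(x₁)| ≤ d·(M − 1)·θ`; `fibreOsc_window` (the same on finite windows `Ω′ → Ω`, as a
  `FibreOsc` for §3) and the end-to-end `hasMaj_coeffDefect_window`.
* §5 THE RATE: `coeff_osc_rate` (`θ = η′G`, `Mη′ = η`, `G, η′ ≥ 0` ⟹ `d(M−1)θ ≤ dηG`), `rate_reading`
  (`dηG = (d·Gℓ²/ℓ)·(η/ℓ)`: with `G = Cℓ^{−2}` of the printed shape the defect is `d·(Cℓ^{−1})·(η/ℓ)` = `d` × the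
  coefficient bound × the rate factor), `rateFactor_one` (`T4EtaRate.rateFactor g 1 y = η/(L^jη)`): the record's
  covariance remark (R1) — the rate weight of a coefficient defect is `(L^j)^{−1}` RELATIVE to the coefficient's own
  (scale-dependent) bound — as a kernel identity for this primitive.
* §6 SLOT CHECK BY NAME: `wrow_diagK` (a diagonal kernel has weighted row norm its size when `d(y,y) = 0`) and
  `hasMaj_idef_mulOp_comp_transfer` = `T4EtaRateDefect.hasMaj_comp_transfer` applied to §2: the coefficient defect
  composed with a coarse factor of majorant `A₀e^{−(ρ+σ)d}` has the source-weighted majorant `εA₀C·e^{−ρd(y,y′)}·w(y′)`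
  for any slow weight `w` (tilt `σ`, constant `C`) dominating the fit error (`o ≤ εw`) — an inhabitant of the (N3)
  `ε_S`-slot shape produced from a background-dependent object (the Leibniz summand `𝔇(M′,M)·T` of
  `T4EtaRateDefect.idef_comp`).
* §7 NON-VACUITY WITH THE RIGHT CONSTANT: one coarse point under two fine points, `a′ = (0, 1)`, `a = a′ ∘ σ = 0`:
  the majorant `diagK 1` holds and `diagK (1/2)` FAILS (the oscillation is attained); and on `ℤ¹`, `M = 3`, `a′(x) = x`,
  `θ = 1` the bound `d(M−1)θ = 2` of §4 is attained between the block's end points.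

HONEST LIMITS.  (a) MECHANISM ONLY: lattices, projections, coefficients, cubes and every bound (`o`, `θ`, `G`, `C`, `w`)
are data; nothing about Bałaban's `A`, `Ū′ⁿ`, or the operators of [B9] is asserted; (3.35) enters as the SHAPE of two
binders.  (b) THE COEFFICIENT HALF ONLY: the defect of the lattice DERIVATIVES / local propagators under pull-back,
`𝔇(∇′, ∇)`, is of order one at block faces and small only inside composites (`T4EtaRateDefect` HONEST LIMIT (b)); it is
not touched here, nor is the non-linear gauge-covariant averaging of (C3) ([B7]) — only its linearisations `sample` /
`blockAvg`.  (c) For `d`-dependent located bounds the hypothesis `InBlockBondBound` is indexed by the block `⌊x/M⌋`; the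
scale dependence of (3.35) (`j` = the index of the cube) enters through `θ`, `o`, `w` as functions of the site, by the
consumer.  NOT NE2⁺, NOT NE1′, NOT the continuum limit, NOT Clay.
-/

noncomputable section

namespace Literature.MathematicalPhysics.QuantumFieldTheory.Balaban1983to89.T4EtaRateCoeffDefect

open Literature.MathematicalPhysics.QuantumFieldTheory.Balaban1983to89.B11SectG (BlockNorm HasMaj)
open Literature.MathematicalPhysics.QuantumFieldTheory.Balaban1983to89.T4EtaRateDefect (idef SlowWeight)
open Literature.MathematicalPhysics.QuantumFieldTheory.Balaban1983to89.B11AxialTransport190 (abs_le_loc_ofBlocks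
  loc_ofBlocks_le)
open Literature.MathematicalPhysics.QuantumFieldTheory.Balaban1983to89.B9SectDWeightedNeumann (WRow)
open Literature.MathematicalPhysics.QuantumFieldTheory.Balaban1983to89.B6RandomWalk (Triangle254)
open Literature.MathematicalPhysics.QuantumFieldTheory.Balaban1983to89.B6Prop26Gluing (mulOp mulOp_apply)
open Literature.MathematicalPhysics.QuantumLattice (blockMap)

/-! ## §1 Pull-back, multiplication operators, and the exact defect formula -/

section Algebra

variable {X X' X'' : Type}

/-- The piecewise-constant PULL-BACK along the block projection `π : X′ → X` of the finer lattice onto the coarser: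
`(pull π f)(x′) = f(π x′)` (convention (C2) of `t4/T4-EST-U1a.md`; Mathlib `LinearMap.funLeft`). [folklore] -/
def pull (π : X' → X) : (X → ℝ) →ₗ[ℝ] (X' → ℝ) := LinearMap.funLeft ℝ ℝ π

/-- Pointwise form of the pull-back. [folklore] -/
@[simp] theorem pull_apply (π : X' → X) (f : X → ℝ) (x' : X') : pull π f x' = f (π x') := rfl

/-- Iterated pull-backs compose contravariantly ((C1): the pairings iterate). [folklore] -/
theorem pull_comp_pull (π : X' → X) (π' : X'' → X') : pull π' ∘ₗ pull π = pull (π ∘ π') := rfl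

/- The MULTIPLICATION OPERATOR `M_a f = a·f` by a coefficient `a` is the tree's `B6Prop26Gluing.mulOp` (BY NAME) — the
shape in which a background field enters the local operators, [B9] (3.50)–(3.53) p. 400, as MECHANISM. -/

/-- THE EXACT DEFECT FORMULA, pointwise: `(M_{a′}τ − τM_a) f (x′) = (a′(x′) − a(πx′))·f(πx′)` — the η-defect of a
coefficient is multiplication by the FIT ERROR `a′ − a ∘ π`. [folklore] -/
theorem idef_mulOp_apply (π : X' → X) (a' : X' → ℝ) (a : X → ℝ) (f : X → ℝ) (x' : X') :
    idef (pull π) (pull π) (mulOp a') (mulOp a) f x' = (a' x' - a (π x')) * f (π x') := by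
  simp only [T4EtaRateDefect.idef_apply, Pi.sub_apply, mulOp_apply, pull_apply]
  ring

/-- THE EXACT DEFECT FORMULA, as operators: `𝔇(M_{a′}, M_a) = M_{a′ − a∘π} ∘ τ`. [folklore] -/
theorem idef_mulOp_eq (π : X' → X) (a' : X' → ℝ) (a : X → ℝ) :
    idef (pull π) (pull π) (mulOp a') (mulOp a) = mulOp (a' - a ∘ π) ∘ₗ pull π := by
  refine LinearMap.ext fun f => funext fun x' => ?_
  rw [idef_mulOp_apply]
  rfl

/-- No defect when the fine coefficient IS the pull-back of the coarse one (`M_{a∘π}τ = τM_a`). [folklore] -/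
theorem idef_mulOp_pull_self (π : X' → X) (a : X → ℝ) :
    idef (pull π) (pull π) (mulOp (a ∘ π)) (mulOp a) = 0 := by
  refine LinearMap.ext fun f => funext fun x' => ?_
  rw [idef_mulOp_apply]
  simp

end Algebra

/-! ## §2 The block majorant of a coefficient defect: diagonal, = the blockwise sup of the fit error -/

section Majorant

variable {X X' : Type} [Fintype X] [Fintype X'] {g : B6.Geometry}

open scoped Classical in
/-- The DIAGONAL kernel `1_{y = y′}·o(y′)` on `𝔅 × 𝔅`. [folklore] -/
def diagK (o : g.Site → ℝ) : g.Site → g.Site → ℝ := fun y y' => if y = y' then o y' else 0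

/-- On the diagonal. [folklore] -/
@[simp] theorem diagK_same (o : g.Site → ℝ) (y : g.Site) : diagK o y y = o y := by
  simp [diagK]

/-- Off the diagonal. [folklore] -/
theorem diagK_ne (o : g.Site → ℝ) {y y' : g.Site} (h : y ≠ y') : diagK o y y' = 0 := by
  simp [diagK, h]

/-- A diagonal kernel with non-negative entries is non-negative. [folklore] -/
theorem diagK_nonneg {o : g.Site → ℝ} (ho : ∀ y, 0 ≤ o y) (y y' : g.Site) : 0 ≤ diagK o y y' := by
  classical
  by_cases h : y = y'
  · subst h
    rw [diagK_same]
    exact ho y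
  · rw [diagK_ne o h]

/-- Monotone in the entries. [folklore] -/
theorem diagK_mono {o o' : g.Site → ℝ} (h : ∀ y, o y ≤ o' y) (y y' : g.Site) : diagK o y y' ≤ diagK o' y y' := by
  classical
  by_cases hy : y = y'
  · subst hy
    simpa using h y
  · rw [diagK_ne o hy, diagK_ne o' hy]

/-- THE ONE ESTIMATE.  A fine-lattice function of the form `x′ ↦ c(x′)·μ(πx′)` with `|c(x′)| ≤ o(blk(πx′))` has, on the
cube `y`, fine block sup `≤ o(y)·`(coarse block sup of `μ` on `y`) — and `0` on every cube other than the one where the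
(localised) coarse input `μ` lives. [folklore] -/
theorem loc_fine_mul_pull_le (blk : X → g.Site) (π : X' → X) {c : X' → ℝ} {o : g.Site → ℝ}
    (ho : ∀ y, 0 ≤ o y) (hc : ∀ x', |c x'| ≤ o (blk (π x'))) {y' : g.Site} {μ : X → ℝ}
    (hμ : (BlockNorm.ofBlocks g blk).IsLoc y' μ) (y : g.Site) :
    (BlockNorm.ofBlocks g (blk ∘ π)).loc y (fun x' => c x' * μ (π x')) ≤
      diagK o y y' * (BlockNorm.ofBlocks g blk).loc y' μ := by
  classical
  have hμ' : ∀ x : X, blk x ≠ y' → μ x = 0 := hμ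
  by_cases hy : y = y'
  · subst hy
    rw [diagK_same]
    refine loc_ofBlocks_le (blk ∘ π) _ (mul_nonneg (ho y) ((BlockNorm.ofBlocks g blk).loc_nonneg y μ))
      fun x' hx' => ?_
    have hx : blk (π x') = y := hx'
    rw [abs_mul]
    exact mul_le_mul (hx ▸ hc x') (abs_le_loc_ofBlocks blk μ hx) (abs_nonneg _) (ho y)
  · rw [diagK_ne o hy, zero_mul]
    refine loc_ofBlocks_le (blk ∘ π) _ le_rfl fun x' hx' => ?_
    have hx : blk (π x') = y := hx'
    have h0 : μ (π x') = 0 := hμ' (π x') (by rw [hx]; exact hy)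
    simp [h0]

/-- THE BLOCK MAJORANT OF A COEFFICIENT DEFECT.  From the FIT HYPOTHESIS `|a′(x′) − a(πx′)| ≤ o(blk(πx′))` (`o ≥ 0`):
`𝔇(M_{a′}, M_a)` has the diagonal majorant `1_{y=y′}·o(y′)` between the sharp block norms of the coarse and the fine
lattice. [folklore] -/
theorem hasMaj_idef_mulOp (blk : X → g.Site) (π : X' → X) {a' : X' → ℝ} {a : X → ℝ} {o : g.Site → ℝ}
    (ho : ∀ y, 0 ≤ o y) (hfit : ∀ x', |a' x' - a (π x')| ≤ o (blk (π x'))) :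
    HasMaj (BlockNorm.ofBlocks g blk) (BlockNorm.ofBlocks g (blk ∘ π))
      (idef (pull π) (pull π) (mulOp a') (mulOp a)) (diagK o) := by
  intro y' μ hμ y
  have hfun : idef (pull π) (pull π) (mulOp a') (mulOp a) μ = fun x' => (a' x' - a (π x')) * μ (π x') :=
    funext fun x' => idef_mulOp_apply π a' a μ x'
  rw [hfun]
  exact loc_fine_mul_pull_le blk π ho hfit hμ y

/-- The pull-back itself is a contraction between the sharp block norms, cube by cube (`diagK 1`). [folklore] -/
theorem hasMaj_pull (blk : X → g.Site) (π : X' → X) :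
    HasMaj (BlockNorm.ofBlocks g blk) (BlockNorm.ofBlocks g (blk ∘ π)) (pull π) (diagK fun _ => 1) := by
  intro y' μ hμ y
  have hfun : pull π μ = fun x' => (1 : ℝ) * μ (π x') := funext fun x' => by simp
  rw [hfun]
  exact loc_fine_mul_pull_le blk π (fun _ => zero_le_one) (fun _ => by simp) hμ y

/-- A multiplication operator with `|a(x)| ≤ m(blk x)` (`m ≥ 0`) has the diagonal majorant `diagK m`. [folklore] -/
theorem hasMaj_mulOp (blk : X → g.Site) {a : X → ℝ} {m : g.Site → ℝ} (hm : ∀ y, 0 ≤ m y)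
    (ha : ∀ x, |a x| ≤ m (blk x)) :
    HasMaj (BlockNorm.ofBlocks g blk) (BlockNorm.ofBlocks g blk) (mulOp a) (diagK m) := by
  intro y' μ hμ y
  exact loc_fine_mul_pull_le blk id hm ha hμ y

/-- A diagonal kernel below `ε·w` on the diagonal is below the source-weighted decay kernel `ε·e^{−ρd(y,y′)}·w(y′)`
(`d(y,y) = 0`). [folklore] -/
theorem diagK_le_decay {o w : g.Site → ℝ} {ε : ℝ} (ρ : ℝ) (ho : ∀ y, 0 ≤ o y) (how : ∀ y, o y ≤ ε * w y)
    (hdiag : ∀ y, g.dist y y = 0) (y y' : g.Site) :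
    diagK o y y' ≤ ε * Real.exp (-(ρ * g.dist y y')) * w y' := by
  classical
  by_cases hy : y = y'
  · subst hy
    rw [diagK_same, hdiag, mul_zero, neg_zero, Real.exp_zero, mul_one]
    exact how y
  · rw [diagK_ne o hy]
    have hεw : 0 ≤ ε * w y' := (ho y').trans (how y')
    calc (0 : ℝ) ≤ Real.exp (-(ρ * g.dist y y')) * (ε * w y') := mul_nonneg (Real.exp_nonneg _) hεw
      _ = ε * Real.exp (-(ρ * g.dist y y')) * w y' := by ring

/-- SOURCE-WEIGHTED DECAY FORM of the coefficient-defect majorant: if the blockwise fit error is dominated by a site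
weight, `o ≤ ε·w`, then `𝔇(M_{a′}, M_a)` has the majorant `ε·e^{−ρd(y,y′)}·w(y′)` at EVERY rate `ρ` — the shape of
the `hDS` slot of `T4EtaRateDefect.idef_neumann_majorant`. [folklore] -/
theorem hasMaj_idef_mulOp_decay (blk : X → g.Site) (π : X' → X) {a' : X' → ℝ} {a : X → ℝ}
    {o w : g.Site → ℝ} {ε : ℝ} (ρ : ℝ) (ho : ∀ y, 0 ≤ o y) (how : ∀ y, o y ≤ ε * w y)
    (hdiag : ∀ y, g.dist y y = 0) (hfit : ∀ x', |a' x' - a (π x')| ≤ o (blk (π x'))) :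
    HasMaj (BlockNorm.ofBlocks g blk) (BlockNorm.ofBlocks g (blk ∘ π))
      (idef (pull π) (pull π) (mulOp a') (mulOp a)) (fun y y' => ε * Real.exp (-(ρ * g.dist y y')) * w y') :=
  (hasMaj_idef_mulOp blk π ho hfit).mono (diagK_le_decay ρ ho how hdiag)

end Majorant

/-! ## §3 Fit error ≤ within-fibre oscillation, for the sample and for the block average -/

section Fit

variable {X X' : Type}

/-- WITHIN-FIBRE OSCILLATION bound of a fine coefficient: `|a′(x₁) − a′(x₂)| ≤ o(πx₁)` whenever `πx₁ = πx₂`.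
[folklore] -/
def FibreOsc (π : X' → X) (a' : X' → ℝ) (o : X → ℝ) : Prop :=
  ∀ x₁ x₂ : X', π x₁ = π x₂ → |a' x₁ - a' x₂| ≤ o (π x₁)

/-- Monotone in the bound. [folklore] -/
theorem FibreOsc.mono {π : X' → X} {a' : X' → ℝ} {o o' : X → ℝ} (h : FibreOsc π a' o) (hle : ∀ x, o x ≤ o' x) :
    FibreOsc π a' o' :=
  fun x₁ x₂ hx => (h x₁ x₂ hx).trans (hle _)

/-- THE SAMPLED COEFFICIENT: for a section `σ` of `π` the coarse coefficient `a = a′ ∘ σ` fits `a′` within the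
oscillation. [folklore] -/
theorem fit_sample (π : X' → X) (σ : X → X') (hσ : ∀ x, π (σ x) = x) {a' : X' → ℝ} {o : X → ℝ}
    (h : FibreOsc π a' o) (x' : X') : |a' x' - (a' ∘ σ) (π x')| ≤ o (π x') :=
  h x' (σ (π x')) (hσ (π x')).symm

section Sample

variable [Fintype X] [Fintype X'] {g : B6.Geometry}

/-- §2 ∘ §3, SAMPLE: with `a = a′ ∘ σ` and the oscillation bound `o ∘ blk`, the coefficient defect has the majorant
`diagK o`. [folklore] -/
theorem hasMaj_idef_mulOp_sample (blk : X → g.Site) (π : X' → X) (σ : X → X') (hσ : ∀ x, π (σ x) = x)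
    {a' : X' → ℝ} {o : g.Site → ℝ} (ho : ∀ y, 0 ≤ o y) (h : FibreOsc π a' (fun x => o (blk x))) :
    HasMaj (BlockNorm.ofBlocks g blk) (BlockNorm.ofBlocks g (blk ∘ π))
      (idef (pull π) (pull π) (mulOp a') (mulOp (a' ∘ σ))) (diagK o) :=
  hasMaj_idef_mulOp blk π ho fun x' => fit_sample π σ hσ h x'

end Sample

section Avg

variable [Fintype X'] [DecidableEq X]

/-- The fibre of `π` over a coarse point, as a finite set. [folklore] -/
def fibre (π : X' → X) (x : X) : Finset X' := Finset.univ.filter fun x' => π x' = x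

/-- Membership in a fibre. [folklore] -/
@[simp] theorem mem_fibre (π : X' → X) (x : X) (x' : X') : x' ∈ fibre π x ↔ π x' = x := by
  simp [fibre]

/-- THE BLOCK AVERAGE of a fine coefficient over the fibres of `π` (the linearisation of convention (C3); junk value `0`
over an empty fibre). [folklore] -/
def blockAvg (π : X' → X) (a' : X' → ℝ) (x : X) : ℝ := (∑ x' ∈ fibre π x, a' x') / (fibre π x).card

/-- THE AVERAGED COEFFICIENT fits `a′` within the oscillation: `|a′(x′) − avg_{π⁻¹(πx′)} a′| ≤ o(πx′)` (the average
of the differences `a′(x′) − a′(x″)` over the fibre). [folklore] -/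
theorem fit_blockAvg (π : X' → X) {a' : X' → ℝ} {o : X → ℝ} (h : FibreOsc π a' o) (x' : X') :
    |a' x' - blockAvg π a' (π x')| ≤ o (π x') := by
  set F : Finset X' := fibre π (π x') with hF
  have hx'F : x' ∈ F := (mem_fibre π (π x') x').2 rfl
  have hcard : (0 : ℝ) < F.card := by exact_mod_cast Finset.card_pos.2 ⟨x', hx'F⟩
  have hrepr : a' x' - blockAvg π a' (π x') = (∑ x'' ∈ F, (a' x' - a' x'')) / F.card := by
    rw [blockAvg, ← hF, Finset.sum_sub_distrib, Finset.sum_const, nsmul_eq_mul, sub_div,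
      mul_div_cancel_left₀ _ hcard.ne']
  rw [hrepr, abs_div, abs_of_pos hcard, div_le_iff₀ hcard]
  calc |∑ x'' ∈ F, (a' x' - a' x'')| ≤ ∑ x'' ∈ F, |a' x' - a' x''| := Finset.abs_sum_le_sum_abs _ _
    _ ≤ ∑ _x'' ∈ F, o (π x') :=
        Finset.sum_le_sum fun x'' hx'' => h x' x'' ((mem_fibre π (π x') x'').1 hx'').symm
    _ = o (π x') * F.card := by rw [Finset.sum_const, nsmul_eq_mul, mul_comm]

variable [Fintype X] {g : B6.Geometry}

/-- §2 ∘ §3, BLOCK AVERAGE: with `a = blockAvg π a′` and the oscillation bound `o ∘ blk`, the coefficient defect has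
the majorant `diagK o`. [folklore] -/
theorem hasMaj_idef_mulOp_blockAvg (blk : X → g.Site) (π : X' → X) {a' : X' → ℝ} {o : g.Site → ℝ}
    (ho : ∀ y, 0 ≤ o y) (h : FibreOsc π a' (fun x => o (blk x))) :
    HasMaj (BlockNorm.ofBlocks g blk) (BlockNorm.ofBlocks g (blk ∘ π))
      (idef (pull π) (pull π) (mulOp a') (mulOp (blockAvg π a'))) (diagK o) :=
  hasMaj_idef_mulOp blk π ho fun x' => fit_blockAvg π h x'

end Avg

end Fit

/-! ## §4 On `ℤ^d`: a located per-bond bound inside blocks gives the oscillation bound `d·(M − 1)·θ` -/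

section Lattice

variable {d : ℕ}

/-- LOCATED PER-BOND HYPOTHESIS on a fine-lattice coefficient `a′ : ℤ^d → ℝ` for the blocks of side `M`: along every
bond `⟨x, x + e_μ⟩` with BOTH ends in one block, `|a′(x + e_μ) − a′(x)| ≤ θ(⌊x/M⌋)` (block faces excluded; `θ`
indexed by the block = the coarse site).  For Bałaban's `A′` this is `θ = η′·sup_□|∇^{η′}A′|`, shaped on (3.35).
[folklore] -/
def InBlockBondBound (M : ℕ) (a' : (Fin d → ℤ) → ℝ) (θ : (Fin d → ℤ) → ℝ) : Prop :=
  ∀ (x : Fin d → ℤ) (μ : Fin d), blockMap M (x + Pi.single μ 1) = blockMap M x →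
    |a' (x + Pi.single μ 1) - a' x| ≤ θ (blockMap M x)

/-- Floor division is constant on integer segments with equal end values. [folklore] -/
theorem ediv_eq_of_mem_segment {M : ℕ} (hM : 0 < M) {u s v c : ℤ} (hus : u ≤ s) (hsv : s ≤ v)
    (hu : u / (M : ℤ) = c) (hv : v / (M : ℤ) = c) : s / (M : ℤ) = c := by
  have hMz : (0 : ℤ) < M := by exact_mod_cast hM
  have h1 : u / (M : ℤ) ≤ s / (M : ℤ) := Int.ediv_le_ediv hMz hus
  have h2 : s / (M : ℤ) ≤ v / (M : ℤ) := Int.ediv_le_ediv hMz hsv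
  omega

/-- Two integers in the same block of side `M` differ by at most `M − 1`. [folklore] -/
theorem abs_sub_le_of_ediv_eq {M : ℕ} (hM : 0 < M) {u v : ℤ} (h : u / (M : ℤ) = v / (M : ℤ)) :
    |u - v| ≤ (M : ℤ) - 1 := by
  have hMz : (0 : ℤ) < M := by exact_mod_cast hM
  have hu := Int.mul_ediv_add_emod u (M : ℤ)
  have hv := Int.mul_ediv_add_emod v (M : ℤ)
  have hu0 := Int.emod_nonneg u hMz.ne'
  have huM := Int.emod_lt_of_pos u hMz
  have hv0 := Int.emod_nonneg v hMz.ne'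
  have hvM := Int.emod_lt_of_pos v hMz
  rw [h] at hu
  rw [abs_le]
  constructor <;> omega

/-- AXIS TELESCOPE: moving `t` unit steps in direction `μ` inside one block costs `≤ t·θ` (every intermediate point
lies in the block, by `ediv_eq_of_mem_segment`). [folklore] -/
theorem axis_telescope {M : ℕ} (hM : 0 < M) {a' : (Fin d → ℤ) → ℝ} {θ : (Fin d → ℤ) → ℝ} (h : InBlockBondBound M a' θ)
    (x : Fin d → ℤ) (μ : Fin d) :
    ∀ t : ℕ, blockMap M (x + Pi.single μ (t : ℤ)) = blockMap M x →
      |a' (x + Pi.single μ (t : ℤ)) - a' x| ≤ (t : ℝ) * θ (blockMap M x)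
  | 0, _ => by simp
  | t + 1, ht => by
    have hpt : x + Pi.single μ (t : ℤ) + Pi.single μ 1 = x + Pi.single μ ((t + 1 : ℕ) : ℤ) := by
      rw [add_assoc, ← Pi.single_add]
      push_cast
      rfl
    have hmid : blockMap M (x + Pi.single μ (t : ℤ)) = blockMap M x := by
      funext i
      show ((x + Pi.single μ (t : ℤ) : Fin d → ℤ) i) / (M : ℤ) = x i / (M : ℤ)
      have hti : ((x + Pi.single μ ((t + 1 : ℕ) : ℤ) : Fin d → ℤ) i) / (M : ℤ) = x i / (M : ℤ) :=
        congr_fun ht i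
      by_cases hi : i = μ
      · subst hi
        simp only [Pi.add_apply, Pi.single_eq_same, Nat.cast_add, Nat.cast_one] at hti ⊢
        exact ediv_eq_of_mem_segment hM (by omega) (by omega) rfl hti
      · simp only [Pi.add_apply, Pi.single_eq_of_ne hi, add_zero]
    have hIH := axis_telescope hM h x μ t hmid
    have hstep : |a' (x + Pi.single μ ((t + 1 : ℕ) : ℤ)) - a' (x + Pi.single μ (t : ℤ))| ≤
        θ (blockMap M x) := by
      have hb := h (x + Pi.single μ (t : ℤ)) μ (by rw [hpt, ht, hmid])
      rw [hpt, hmid] at hb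
      exact hb
    calc |a' (x + Pi.single μ ((t + 1 : ℕ) : ℤ)) - a' x|
        = |(a' (x + Pi.single μ ((t + 1 : ℕ) : ℤ)) - a' (x + Pi.single μ (t : ℤ))) +
            (a' (x + Pi.single μ (t : ℤ)) - a' x)| := by congr 1; ring
      _ ≤ θ (blockMap M x) + (t : ℝ) * θ (blockMap M x) := (abs_add_le _ _).trans (add_le_add hstep hIH)
      _ = ((t + 1 : ℕ) : ℝ) * θ (blockMap M x) := by push_cast; ring

/-- A signed axis move inside one block costs `≤ |s|·θ`. [folklore] -/
theorem axis_step_abs {M : ℕ} (hM : 0 < M) {a' : (Fin d → ℤ) → ℝ} {θ : (Fin d → ℤ) → ℝ} (h : InBlockBondBound M a' θ)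
    (z : Fin d → ℤ) (μ : Fin d) (s : ℤ) (hblk : blockMap M (z + Pi.single μ s) = blockMap M z) :
    |a' (z + Pi.single μ s) - a' z| ≤ (s.natAbs : ℝ) * θ (blockMap M z) := by
  obtain ⟨t, rfl | rfl⟩ := Int.eq_nat_or_neg s
  · simpa using axis_telescope hM h z μ t hblk
  · -- move back from the end point `z' = z − t e_μ`, which lies in the same block
    set z' : Fin d → ℤ := z + Pi.single μ (-(t : ℤ)) with hz'
    have hback : z' + Pi.single μ (t : ℤ) = z := by
      rw [hz', add_assoc, ← Pi.single_add, neg_add_cancel, Pi.single_zero, add_zero]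
    have hblk' : blockMap M (z' + Pi.single μ (t : ℤ)) = blockMap M z' := by rw [hback, ← hblk]
    have key := axis_telescope hM h z' μ t hblk'
    rw [hback] at key
    rw [abs_sub_comm, ← hblk]
    simpa using key

/-- COORDINATE MIXING: the point with the first `k` coordinates of `x₂` and the remaining ones of `x₁`. [folklore] -/
def mix (x₁ x₂ : Fin d → ℤ) (k : ℕ) : Fin d → ℤ := fun i => if (i : ℕ) < k then x₂ i else x₁ i

/-- `mix … 0 = x₁`. [folklore] -/
theorem mix_zero (x₁ x₂ : Fin d → ℤ) : mix x₁ x₂ 0 = x₁ := funext fun i => by simp [mix]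

/-- `mix … k = x₂` once `k ≥ d`. [folklore] -/
theorem mix_of_le (x₁ x₂ : Fin d → ℤ) {k : ℕ} (hk : d ≤ k) : mix x₁ x₂ k = x₂ :=
  funext fun i => by simp [mix, lt_of_lt_of_le i.is_lt hk]

/-- One more coordinate: `mix … (k+1) = mix … k + (x₂ − x₁)_k e_k`. [folklore] -/
theorem mix_succ (x₁ x₂ : Fin d → ℤ) (k : ℕ) (hk : k < d) :
    mix x₁ x₂ (k + 1) = mix x₁ x₂ k + Pi.single (⟨k, hk⟩ : Fin d) (x₂ ⟨k, hk⟩ - x₁ ⟨k, hk⟩) := by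
  funext i
  by_cases hi : i = ⟨k, hk⟩
  · subst hi
    simp [mix]
  · have hik : (i : ℕ) ≠ k := fun hh => hi (Fin.ext hh)
    have hiff : ((i : ℕ) < k + 1) ↔ ((i : ℕ) < k) := by omega
    simp only [mix, Pi.add_apply, Pi.single_eq_of_ne hi, add_zero, hiff]

/-- Mixed points of two points of one block stay in the block (`blockMap` acts coordinatewise). [folklore] -/
theorem blockMap_mix (M : ℕ) {x₁ x₂ : Fin d → ℤ} (h : blockMap M x₁ = blockMap M x₂) (k : ℕ) :
    blockMap M (mix x₁ x₂ k) = blockMap M x₁ := by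
  funext i
  show (mix x₁ x₂ k) i / (M : ℤ) = x₁ i / (M : ℤ)
  simp only [mix]
  split_ifs
  · exact (congr_fun h i).symm
  · rfl

/-- THE OSCILLATION BOUND.  Two points of one block of side `M` (`M ≥ 1`, `θ ≥ 0`) are joined INSIDE the block by a
monotone axis path of `Σ_i |x₂,i − x₁,i| ≤ d·(M − 1)` bonds, so `|a′(x₂) − a′(x₁)| ≤ d·(M − 1)·θ(block)`.
[folklore] -/
theorem osc_of_inBlockBondBound {M : ℕ} (hM : 0 < M) {a' : (Fin d → ℤ) → ℝ} {θ : (Fin d → ℤ) → ℝ} (hθ : ∀ y, 0 ≤ θ y)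
    (h : InBlockBondBound M a' θ) {x₁ x₂ : Fin d → ℤ} (hx : blockMap M x₁ = blockMap M x₂) :
    |a' x₂ - a' x₁| ≤ (d : ℝ) * ((M : ℝ) - 1) * θ (blockMap M x₁) := by
  suffices hk : ∀ k : ℕ, k ≤ d →
      |a' (mix x₁ x₂ k) - a' x₁| ≤ (k : ℝ) * ((M : ℝ) - 1) * θ (blockMap M x₁) by
    simpa [mix_of_le x₁ x₂ le_rfl] using hk d le_rfl
  intro k
  induction k with
  | zero =>
    intro _
    simp [mix_zero]
  | succ k ih =>
    intro hk
    have hk' : k < d := hk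
    have hprev := ih hk'.le
    have hM1 : ((x₂ ⟨k, hk'⟩ - x₁ ⟨k, hk'⟩).natAbs : ℝ) ≤ (M : ℝ) - 1 := by
      have hz : |x₂ ⟨k, hk'⟩ - x₁ ⟨k, hk'⟩| ≤ (M : ℤ) - 1 :=
        abs_sub_le_of_ediv_eq hM (congr_fun hx ⟨k, hk'⟩).symm
      have hzR : (((|x₂ ⟨k, hk'⟩ - x₁ ⟨k, hk'⟩| : ℤ) : ℝ)) ≤ (((M : ℤ) - 1 : ℤ) : ℝ) := Int.cast_le.mpr hz
      rw [Nat.cast_natAbs]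
      simpa using hzR
    have hstep : |a' (mix x₁ x₂ (k + 1)) - a' (mix x₁ x₂ k)| ≤ ((M : ℝ) - 1) * θ (blockMap M x₁) := by
      have hin : blockMap M (mix x₁ x₂ k + Pi.single (⟨k, hk'⟩ : Fin d) (x₂ ⟨k, hk'⟩ - x₁ ⟨k, hk'⟩)) =
          blockMap M (mix x₁ x₂ k) := by
        rw [← mix_succ x₁ x₂ k hk', blockMap_mix M hx (k + 1), blockMap_mix M hx k]
      have hb := axis_step_abs hM h (mix x₁ x₂ k) ⟨k, hk'⟩ _ hin
      rw [← mix_succ x₁ x₂ k hk', blockMap_mix M hx k] at hb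
      exact hb.trans (mul_le_mul_of_nonneg_right hM1 (hθ _))
    calc |a' (mix x₁ x₂ (k + 1)) - a' x₁|
        = |(a' (mix x₁ x₂ (k + 1)) - a' (mix x₁ x₂ k)) + (a' (mix x₁ x₂ k) - a' x₁)| := by
          congr 1; ring
      _ ≤ ((M : ℝ) - 1) * θ (blockMap M x₁) + (k : ℝ) * ((M : ℝ) - 1) * θ (blockMap M x₁) :=
          (abs_add_le _ _).trans (add_le_add hstep hprev)
      _ = ((k + 1 : ℕ) : ℝ) * ((M : ℝ) - 1) * θ (blockMap M x₁) := by push_cast; ring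

/-- The block projection between two finite WINDOWS `Ω′ → Ω` of `ℤ^d` (`Ω` containing the blocks of `Ω′`).
[folklore] -/
def blockProj (M : ℕ) (Ω' Ω : Finset (Fin d → ℤ)) (hΩ : ∀ x ∈ Ω', blockMap M x ∈ Ω) :
    {x // x ∈ Ω'} → {y // y ∈ Ω} :=
  fun x => ⟨blockMap M x.1, hΩ x.1 x.2⟩

/-- The block projection, on underlying points. [folklore] -/
@[simp] theorem blockProj_val (M : ℕ) (Ω' Ω : Finset (Fin d → ℤ)) (hΩ : ∀ x ∈ Ω', blockMap M x ∈ Ω)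
    (x : {x // x ∈ Ω'}) : ((blockProj M Ω' Ω hΩ x : {y // y ∈ Ω}) : Fin d → ℤ) = blockMap M x.1 := rfl

/-- ON WINDOWS: the located per-bond bound gives the `FibreOsc` hypothesis of §3 with the oscillation
`d·(M − 1)·θ(y)`. [folklore] -/
theorem fibreOsc_window {M : ℕ} (hM : 0 < M) {a' : (Fin d → ℤ) → ℝ} {θ : (Fin d → ℤ) → ℝ} (hθ : ∀ y, 0 ≤ θ y)
    (h : InBlockBondBound M a' θ) (Ω' Ω : Finset (Fin d → ℤ)) (hΩ : ∀ x ∈ Ω', blockMap M x ∈ Ω) :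
    FibreOsc (blockProj M Ω' Ω hΩ) (fun x => a' x.1) (fun y => (d : ℝ) * ((M : ℝ) - 1) * θ y.1) := by
  intro x₁ x₂ hπ
  have hx : blockMap M x₂.1 = blockMap M x₁.1 := (congrArg Subtype.val hπ).symm
  simpa [hx] using osc_of_inBlockBondBound hM hθ h hx

/-- END TO END ON WINDOWS (sampled coarse coefficient): a located per-bond bound `θ` on the fine coefficient `a′`
inside the blocks of side `M` gives the coefficient defect `𝔇(M_{a′}, M_{a′∘σ})` the diagonal block majorant
`1_{y=y′}·o(y′)` for any cube bound `o ≥ d(M−1)θ` on the cube's coarse sites. [folklore] -/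
theorem hasMaj_coeffDefect_window {g : B6.Geometry} {M : ℕ} (hM : 0 < M) {a' : (Fin d → ℤ) → ℝ} {θ : (Fin d → ℤ) → ℝ}
    (hθ : ∀ y, 0 ≤ θ y) (h : InBlockBondBound M a' θ) (Ω' Ω : Finset (Fin d → ℤ))
    (hΩ : ∀ x ∈ Ω', blockMap M x ∈ Ω) (blk : {y // y ∈ Ω} → g.Site)
    (σ : {y // y ∈ Ω} → {x // x ∈ Ω'}) (hσ : ∀ y, blockProj M Ω' Ω hΩ (σ y) = y)
    {o : g.Site → ℝ} (ho : ∀ b, 0 ≤ o b) (hθo : ∀ y : {y // y ∈ Ω}, (d : ℝ) * ((M : ℝ) - 1) * θ y.1 ≤ o (blk y)) :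
    HasMaj (BlockNorm.ofBlocks g blk) (BlockNorm.ofBlocks g (blk ∘ blockProj M Ω' Ω hΩ))
      (idef (pull (blockProj M Ω' Ω hΩ)) (pull (blockProj M Ω' Ω hΩ))
        (mulOp fun x => a' x.1) (mulOp ((fun x => a' x.1) ∘ σ))) (diagK o) :=
  hasMaj_idef_mulOp_sample blk _ σ hσ ho ((fibreOsc_window hM hθ h Ω' Ω hΩ).mono hθo)

end Lattice

/-! ## §5 The rate: per-bond variation `η′G` ⟹ relative size one rate factor `η/ℓ` (γ = 1) -/

section Rate

/-- THE ARITHMETIC OF NE2-LOCAL-A: with the fine spacing `η′`, `Mη′ = η`, and the per-bond variation `θ = η′·G`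
(`G ≥ 0` a bound on the fine lattice gradient), the oscillation bound `d(M−1)θ` is `≤ d·η·G`. [folklore] -/
theorem coeff_osc_rate (d M : ℕ) {θ η η' G : ℝ} (hη' : 0 ≤ η') (hG : 0 ≤ G) (hθ : θ = η' * G)
    (hMη : (M : ℝ) * η' = η) : (d : ℝ) * ((M : ℝ) - 1) * θ ≤ d * η * G := by
  subst hθ
  have h1 : ((M : ℝ) - 1) * η' ≤ η := by nlinarith
  calc (d : ℝ) * ((M : ℝ) - 1) * (η' * G) = d * (((M : ℝ) - 1) * η') * G := by ring
    _ ≤ d * η * G := by gcongr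

/-- THE RATE READING ((R1) of `t4/T4-EST-U1a.md`): `d·η·G = (d·Gℓ)·(η/ℓ)` — with the printed SHAPE `G = C·ℓ^{−2}`,
`ℓ = L^jη` ((3.35): gradient bound one power of `ℓ` below the coefficient bound `C·ℓ^{−1}`) the coefficient defect is
`d ×` (coefficient bound) `×` (rate factor `η/ℓ`, `γ = 1`). [folklore] -/
theorem rate_reading (d : ℕ) {η G C ℓ : ℝ} (hℓ : ℓ ≠ 0) (hG : G = C * ℓ⁻¹ ^ 2) :
    (d : ℝ) * η * G = ((d : ℝ) * (C * ℓ⁻¹)) * (η / ℓ) := by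
  subst hG
  field_simp

/-- DICTIONARY: the rate factor of `T4EtaRate` at `γ = 1` is `η/(L^jη)`. [folklore] -/
theorem rateFactor_one (g : B9.Geometry) (y : g.Site) : T4EtaRate.rateFactor g 1 y = g.eta / g.len y := by
  rw [T4EtaRate.rateFactor, Real.rpow_one]

end Rate

/-! ## §6 Slot check by name: the coefficient defect inside a composite is an (N3)-shaped source defect rate -/

section Slot

variable {X X' : Type} [Fintype X] [Fintype X'] {g : B6.Geometry}

/-- A diagonal kernel of constant size `ε` has weighted row norm `ε` at every rate (`d(y,y) = 0`). [folklore] -/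
theorem wrow_diagK (ρ ε : ℝ) (hdiag : ∀ y, g.dist y y = 0) : WRow g ρ (diagK fun _ : g.Site => ε) ε := by
  classical
  intro y
  have hsum : ∑ y' : g.Site, diagK (fun _ : g.Site => ε) y y' * Real.exp (ρ * g.dist y y') =
      ε * Real.exp (ρ * g.dist y y) := by
    rw [Finset.sum_eq_single y]
    · rw [diagK_same]
    · intro y' _ hy'
      rw [diagK_ne _ (Ne.symm hy'), zero_mul]
    · intro hy
      exact absurd (Finset.mem_univ y) hy
  rw [hsum, hdiag, mul_zero, Real.exp_zero, mul_one]

/-- THE COEFFICIENT DEFECT INSIDE A COMPOSITE (`T4EtaRateDefect.hasMaj_comp_transfer` BY NAME): if the blockwise fit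
error is dominated by a slow site weight, `o ≤ ε·w` (`w ≥ 0` of tilt `σ` and constant `C`, e.g. the η-rate weight
`T4EtaRateDefect.rateWeight`), then `𝔇(M_{a′}, M_a)·T`, for any coarse factor `T` of majorant `A₀e^{−(ρ+σ)d}`, has the
SOURCE-WEIGHTED majorant `εA₀C·e^{−ρd(y,y′)}·w(y′)` — the `hDS`-slot shape of `T4EtaRateDefect.idef_neumann_majorant`
for the Leibniz summand `𝔇(M′,M)·T` of `T4EtaRateDefect.idef_comp`. [folklore] -/
theorem hasMaj_idef_mulOp_comp_transfer {F₁ : Type} [AddCommGroup F₁] [Module ℝ F₁] {b₁ : BlockNorm g F₁}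
    (blk : X → g.Site) (π : X' → X) {a' : X' → ℝ} {a : X → ℝ} {o w : g.Site → ℝ} {ε ρ σ C A₀ : ℝ}
    {T : F₁ →ₗ[ℝ] (X → ℝ)}
    (htri : Triangle254 g) (hdiag : ∀ y, g.dist y y = 0) (hρ : 0 ≤ ρ) (hA₀ : 0 ≤ A₀) (hC : 0 ≤ C)
    (hε : 0 ≤ ε) (hw : ∀ y, 0 ≤ w y) (hsw : SlowWeight g σ C w)
    (ho : ∀ y, 0 ≤ o y) (how : ∀ y, o y ≤ ε * w y) (hfit : ∀ x', |a' x' - a (π x')| ≤ o (blk (π x')))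
    (hT : HasMaj b₁ (BlockNorm.ofBlocks g blk) T (fun y y' => A₀ * Real.exp (-((ρ + σ) * g.dist y y')))) :
    HasMaj b₁ (BlockNorm.ofBlocks g (blk ∘ π)) (idef (pull π) (pull π) (mulOp a') (mulOp a) ∘ₗ T)
      (fun y y' => ε * A₀ * C * Real.exp (-(ρ * g.dist y y')) * w y') := by
  classical
  have h₁ : HasMaj (BlockNorm.ofBlocks g blk) (BlockNorm.ofBlocks g (blk ∘ π))
      (idef (pull π) (pull π) (mulOp a') (mulOp a)) (fun y y'' => diagK (fun _ : g.Site => ε) y y'' * w y'') := by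
    refine (hasMaj_idef_mulOp blk π ho hfit).mono fun y y'' => ?_
    by_cases hy : y = y''
    · subst hy
      simpa using how y
    · rw [diagK_ne o hy, diagK_ne _ hy, zero_mul]
  have key := T4EtaRateDefect.hasMaj_comp_transfer htri hρ hA₀ hC (diagK_nonneg fun _ => hε) hw hsw
    (wrow_diagK ρ ε hdiag) h₁ hT
  have hκ : (BlockNorm.ofBlocks g blk).κ = 1 := rfl
  simpa only [hκ, one_mul] using key

end Slot

/-! ## §7 Non-vacuity with the right constant -/

section Toy

open T4EtaRateDefect (toyG)

/-- Two fine points over one coarse point. [folklore] -/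
def toyπ : Fin 2 → Fin 1 := fun _ => 0

/-- The fine coefficient `(0, 1)`: oscillation exactly `1` over the single fibre. [folklore] -/
def toyA : Fin 2 → ℝ := fun i => (i : ℕ)

/-- Its oscillation bound `1`. [folklore] -/
theorem toy_fibreOsc : FibreOsc toyπ toyA (fun _ => 1) := by
  intro x₁ x₂ _
  fin_cases x₁ <;> fin_cases x₂ <;> simp [toyA]

/-- THE MAJORANT HOLDS with `o = 1` (sampled coarse coefficient at the section `0 ↦ 0`, i.e. `a = 0`). [folklore] -/
theorem toy_hasMaj :
    HasMaj (BlockNorm.ofBlocks toyG (fun _ : Fin 1 => ())) (BlockNorm.ofBlocks toyG ((fun _ : Fin 1 => ()) ∘ toyπ))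
      (idef (pull toyπ) (pull toyπ) (mulOp toyA) (mulOp (toyA ∘ fun _ : Fin 1 => (0 : Fin 2))))
      (diagK fun _ => 1) :=
  hasMaj_idef_mulOp_sample (g := toyG) (fun _ : Fin 1 => ()) toyπ (fun _ => 0) (fun x => by fin_cases x; rfl)
    (fun _ => zero_le_one) toy_fibreOsc

/-- MUST-FAIL TWIN: the majorant `diagK (1/2)` is FALSE for the same defect — on the input `μ ≡ 1` the defect is the
function `(0, 1)` of fine block sup `1 > 1/2·1`. [folklore] -/
theorem toy_not_hasMaj_half :
    ¬ HasMaj (BlockNorm.ofBlocks toyG (fun _ : Fin 1 => ())) (BlockNorm.ofBlocks toyG ((fun _ : Fin 1 => ()) ∘ toyπ))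
      (idef (pull toyπ) (pull toyπ) (mulOp toyA) (mulOp (toyA ∘ fun _ : Fin 1 => (0 : Fin 2))))
      (diagK fun _ => (1 / 2 : ℝ)) := by
  intro hmaj
  have hloc : (BlockNorm.ofBlocks toyG (fun _ : Fin 1 => ())).IsLoc () (fun _ : Fin 1 => (1 : ℝ)) :=
    fun x hx => absurd rfl hx
  have h := hmaj () (fun _ => (1 : ℝ)) hloc ()
  have hup : (BlockNorm.ofBlocks toyG (fun _ : Fin 1 => ())).loc () (fun _ : Fin 1 => (1 : ℝ)) ≤ 1 :=
    loc_ofBlocks_le _ _ zero_le_one fun _ _ => by simp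
  have hlow : (1 : ℝ) ≤ (BlockNorm.ofBlocks toyG ((fun _ : Fin 1 => ()) ∘ toyπ)).loc ()
      (idef (pull toyπ) (pull toyπ) (mulOp toyA) (mulOp (toyA ∘ fun _ : Fin 1 => (0 : Fin 2)))
        (fun _ : Fin 1 => (1 : ℝ))) := by
    have := abs_le_loc_ofBlocks (g := toyG) ((fun _ : Fin 1 => ()) ∘ toyπ)
      (idef (pull toyπ) (pull toyπ) (mulOp toyA) (mulOp (toyA ∘ fun _ : Fin 1 => (0 : Fin 2)))
        (fun _ : Fin 1 => (1 : ℝ))) (x' := (1 : Fin 2)) (y := ()) rfl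
    simpa [idef_mulOp_apply, toyA] using this
  rw [diagK_same] at h
  linarith

/-- ON `ℤ¹`, `M = 3`, `a′(x) = x`, `θ ≡ 1`: the per-bond hypothesis holds … [folklore] -/
theorem toy_inBlock : InBlockBondBound 3 (fun x : Fin 1 → ℤ => (x 0 : ℝ)) (fun _ => 1) := by
  intro x μ _
  have hμ : μ = 0 := Subsingleton.elim μ 0
  subst hμ
  simp

/-- … and §4's bound `d(M−1)θ = 2` is ATTAINED between the end points `0` and `2` of the block `{0,1,2}`. [folklore] -/
example : |((fun x : Fin 1 → ℤ => (x 0 : ℝ)) (fun _ => 2)) - (fun x : Fin 1 → ℤ => (x 0 : ℝ)) (fun _ => 0)| =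
    (1 : ℝ) * ((3 : ℝ) - 1) * 1 ∧
    |((fun x : Fin 1 → ℤ => (x 0 : ℝ)) (fun _ => 2)) - (fun x : Fin 1 → ℤ => (x 0 : ℝ)) (fun _ => 0)| ≤
    ((1 : ℕ) : ℝ) * (((3 : ℕ) : ℝ) - 1) * (fun _ : Fin 1 → ℤ => (1 : ℝ)) (blockMap 3 (fun _ : Fin 1 => (0 : ℤ))) :=
  ⟨by norm_num, osc_of_inBlockBondBound (by norm_num) (fun _ => zero_le_one) toy_inBlock
    (x₁ := fun _ => 0) (x₂ := fun _ => 2) (funext fun _ => rfl)⟩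

end Toy

end Literature.MathematicalPhysics.QuantumFieldTheory.Balaban1983to89.T4EtaRateCoeffDefect
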